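import Mathlib
import Summits.AtomisticToContinuum.HydrodynamicLimit.Theorems.ImplosionDichotomyDenseExcursionPackingResolventInnerPoint
import Summits.AtomisticToContinuum.HydrodynamicLimit.Theorems.ImplosionDichotomyDenseExcursionPackingResolventInnerTouch
import Summits.AtomisticToContinuum.HydrodynamicLimit.Theorems.ImplosionDichotomyDenseExcursionPackingResolventOuterBarrier
import Summits.AtomisticToContinuum.HydrodynamicLimit.Theorems.ImplosionDichotomyDenseExcursionPackingResolventSonicWindow
import Literature.Analysis.ODE.BarrierTouching

/-!
# The outer region of the packing-resolvent gain: the touching cases `P`, `M` and the interface case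
# (crux `DenseExcursion`, stmt-AtomisticToContinuum-12586, line `sonic-cavity-renewal` v8, stub `stub_packingResolventW`)

Helper file (`--supports stmt-AtomisticToContinuum-12586`) for the registered stub `stub_packingResolventW` (skeleton v8;
registered helper here: `packingResolventW_interfaceQ`). THE ANALYTIC HALF OF THE OUTER REGION `x ≥ x_Λ` of the barrier
a-priori estimate: characteristic fields `P = u₁ + 3u₂`, `M = u₁ − 3u₂` (landed `charP_eq`, `charM_eq`), barriers
`P̄ = (N/Λ)(2 + 100S) + ηeˣ`, `M̄ = (N/Λ)(2 + 75S) + ηeˣ`. Given `θ ≥ 0` dominating the outer gauges on `x ≥ x_Λ` and the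
inner `U`-gauge at `x_Λ`, `outer_cases` proves: if `|P|/P̄` attains `θ` at some `x⋆ ≥ x_Λ` (interior, or the OUTFLOW
endpoint `x_Λ` where `c₊ = W − 1 + S > 0`), or `|M|/M̄` attains `θ` at an interior `x⋆ > x_Λ`, then `θ ≤ 1`
(`Literature.Analysis.ODE.barrier_touching'` + the landed slack inequalities `outer_BP/BM_zoneA/B` + `outer_touch_arith`);
and if `|M|/M̄` attains `θ` at the INFLOW endpoint `x_Λ` then `θ = 0` by the interface identity
`M(x_Λ) = U(x_Λ) + λ(ψ(2) − qφ(2))`, `q = 3s₀/(2s̃)` (`packingResolventW_interfaceQ`: `|q − 3/2| ≤ 10⁻⁵`) and the landed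
reflection bound `bessel_reflection` with `inner_interface_M`.
-/

noncomputable section

open Set

namespace Summit.AtomisticToContinuum.HydrodynamicLimit.Theorems.PackingAnalyticImplosion

/-- **Registered helper `packingResolventW_interfaceQ` of `stub_packingResolventW`: THE INTERFACE RATIO.** With
`s̃ = eS ∈ [7/10, 1]`, `|s̃ − s₀| ≤ δ²`, `δ ≤ 1/1000`, `s₀ ≥ 7/10`: `q = 3s₀/(2s̃)` satisfies `|q − 3/2| ≤ 10⁻⁵`, and
`(N/Λ)(2 + 75S) ≥ 37.49N` when `eΛ = 2s₀` (the `M`-barrier at the interface). [folklore] -/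
theorem packingResolventW_interfaceQ : ∀ (Λ δ s₀ N e Sv : ℝ), δ * Λ = 1 → 0 < δ → δ ≤ 1 / 1000 → 7 / 10 ≤ s₀ → e * Λ = 2 * s₀ → 7 / 10 ≤ Sv * e → |Sv * e - s₀| ≤ δ ^ 2 → 0 < N → |3 * s₀ / (2 * (Sv * e)) - 3 / 2| ≤ 1 / 100000 ∧ 3749 / 100 * N ≤ N / Λ * (2 + 75 * Sv) := by
  intro Λ δ s₀ N e Sv hδΛ hδ hδ' hs₀ heΛ hst1 hst0 hN
  have hΛ : 1000 ≤ Λ := thousand_le_of_delta hδΛ hδ hδ'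
  have hΛpos : 0 < Λ := by linarith
  obtain ⟨hsl, hsu⟩ := abs_le.1 hst0
  have hδ2 : δ ^ 2 ≤ 1 / 1000000 := by
    calc δ ^ 2 ≤ (1 / 1000) ^ 2 := pow_le_pow_left₀ hδ.le hδ' 2
      _ = 1 / 1000000 := by norm_num
  have hst : 0 < Sv * e := by linarith
  constructor
  · obtain ⟨st, hst_eq⟩ : ∃ st : ℝ, Sv * e = st := ⟨_, rfl⟩
    rw [hst_eq] at hst hst1 hst0 ⊢
    have e1 : 3 * s₀ / (2 * st) - 3 / 2 = 3 / 2 * ((s₀ - st) / st) := by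
      field_simp
    rw [e1, abs_mul, abs_of_pos (by norm_num : (0:ℝ) < 3 / 2), abs_div, abs_of_pos hst, abs_sub_comm]
    have h1 : |st - s₀| / st ≤ (1 / 1000000) / (7 / 10) :=
      calc |st - s₀| / st ≤ |st - s₀| / (7 / 10) := div_le_div_of_nonneg_left (abs_nonneg _) (by norm_num) hst1
        _ ≤ (1 / 1000000) / (7 / 10) := div_le_div_of_nonneg_right (hst0.trans hδ2) (by norm_num)
    linarith
  · -- `N/Λ · (2 + 75 Sv) ≥ 75 N Sv / Λ` and `75 Sv ≥ (3749/100) Λ` since `Λ = 2s₀/e`, `Sv e ≥ s₀ − δ²`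
    have he : 0 < e := by
      by_contra hcon; push Not at hcon
      have : e * Λ ≤ 0 := mul_nonpos_of_nonpos_of_nonneg hcon hΛpos.le
      linarith
    have h3 : 3749 / 100 * (e * Λ) ≤ 75 * (Sv * e) := by rw [heΛ]; linarith
    have h4 : 3749 / 100 * Λ * e ≤ 75 * Sv * e := by linarith [show 75 * (Sv * e) = 75 * Sv * e by ring,
      show 3749 / 100 * (e * Λ) = 3749 / 100 * Λ * e by ring]
    have h5 : 3749 / 100 * Λ ≤ 75 * Sv := le_of_mul_le_mul_right h4 he
    have e2 : N / Λ * (2 + 75 * Sv) = N * (2 + 75 * Sv) / Λ := by ring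
    rw [e2, le_div_iff₀ hΛpos]
    have h6 : N * (3749 / 100 * Λ) ≤ N * (75 * Sv) := mul_le_mul_of_nonneg_left h5 hN.le
    nlinarith only [h6, hN]

/-- **THE OUTER TOUCHING CASES AND THE INTERFACE.** Data: the pinned window, `Λ ≥ 1000`, `Λ ≥ 700B₀²` (`δΛ = 1`),
`e^{x_Λ} = 2s₀/Λ`, the digested tube (`htc`, `htd`, `|S + S′| ≤ 11/5` on `x ≤ 0`, sonic signs, one bound `B₀` on `x ≥ 0`,
`S` decreasing on `x ≤ 1`), a differentiable real solution with a `(1 + S)`-weighted source of size `N`, the matching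
constant `λφ(2) = V(x_Λ)`, `0 ≤ η ≤ N/100`, and `θ ≥ 0` dominating the outer gauges on `x ≥ x_Λ` and the inner `U`-gauge at
`x_Λ`, together with the size `|λ|φ(2) ≤ 29.18θN` of the matching constant (landed `packingResolventW_lamBound`). Conclusion:
if `|P| = θP̄` at some `x⋆ ≥ x_Λ`, or `|M| = θM̄` at some `x⋆ ≥ x_Λ`, then `θ ≤ 1`. [folklore] -/
theorem outer_cases (r Λ δ s₀ N η θ lam xL B₀ : ℝ) (W S u₁ u₂ f₁ f₂ : ℝ → ℝ)
    (hr1 : 17307 / 15625 ≤ r) (hδΛ : δ * Λ = 1) (hδ : 0 < δ) (hδ' : δ ≤ 1 / 1000)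
    (hB : 1 ≤ B₀) (hΛB : 700 * B₀ ^ 2 ≤ Λ)
    (hs₀ : 7 / 10 ≤ s₀) (hs₀' : s₀ ≤ 1) (hxL : Real.exp xL = 2 * s₀ / Λ) (hN : 0 < N)
    (hη : 0 ≤ η) (hηN : η ≤ N / 100) (hθ : 0 ≤ θ) (hSpos : ∀ x, 0 < S x) (hSd : Differentiable ℝ S)
    (hu₁ : Differentiable ℝ u₁) (hu₂ : Differentiable ℝ u₂)
    (htc : (∀ x, x ≤ 1 → |W x| ≤ 1 / 4 ∧ |deriv W x| ≤ 1 / 2 ∧ 7 / 10 ≤ Real.exp x * S x ∧ Real.exp x * S x ≤ 1))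
    (htd : (∀ x, x ≤ 0 → |W x - (r - 1)| ≤ Real.exp x ^ 2 / 10 + 2 * Real.exp x ^ 4 ∧ |deriv W x| ≤ Real.exp x ^ 2 / 5 + 2 * Real.exp x ^ 4 ∧ |Real.exp x * S x - s₀| ≤ Real.exp x ^ 2 / 10 + 2 * Real.exp x ^ 4 ∧ |Real.exp x * (S x + deriv S x)| ≤ Real.exp x ^ 2 / 5 + 2 * Real.exp x ^ 4))
    (hτ : ∀ x, x ≤ 0 → |S x + deriv S x| ≤ 11 / 5)
    (hsup : ∀ x, x < 0 → 1 < W x + S x) (hsub : ∀ x, 0 ≤ x → W x + S x ≤ 1)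
    (hB0 : ∀ x, 0 ≤ x → |W x| ≤ B₀ ∧ |deriv W x| ≤ B₀ ∧ S x ≤ B₀ ∧ |deriv S x| ≤ B₀)
    (hSanti : ∀ x y, x ≤ y → y ≤ 1 → S y ≤ S x)
    (heq : ∀ x, Λ * u₁ x - ((W x - 1) * deriv u₁ x + 3 * S x * deriv u₂ x + (deriv W x + 2 * W x - r) * u₁ x + (3 * deriv S x + 6 * S x) * u₂ x) = f₁ x ∧ Λ * u₂ x - (S x / 3 * deriv u₁ x + (W x - 1) * deriv u₂ x + (deriv S x + 2 * S x) * u₁ x + (deriv W x / 3 + 2 * W x - r) * u₂ x) = f₂ x)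
    (hf : ∀ y, |f₁ y| / (1 + S y) + |f₂ y| / S y ≤ N)
    (hlam : lam * (94253 / 51975) = (Λ * Real.exp xL ^ 2 * S xL * u₂ xL / s₀ ^ 2))
    (hθP : ∀ x, xL ≤ x → |u₁ x + 3 * u₂ x| ≤ θ * (N / Λ * (2 + 100 * S x) + η * Real.exp x))
    (hθM : ∀ x, xL ≤ x → |u₁ x - 3 * u₂ x| ≤ θ * (N / Λ * (2 + 75 * S x) + η * Real.exp x))
    (hθU : |u₁ xL - lam * (15193 / 10395 : ℝ)| ≤ θ * (9 * N))
    (hlamV : |lam| * (94253 / 51975) ≤ θ * (2918 / 100) * N) :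
    (∀ xs, xL ≤ xs → |u₁ xs + 3 * u₂ xs| = θ * (N / Λ * (2 + 100 * S xs) + η * Real.exp xs) → θ ≤ 1) ∧
    (∀ xs, xL ≤ xs → |u₁ xs - 3 * u₂ xs| = θ * (N / Λ * (2 + 75 * S xs) + η * Real.exp xs) → θ ≤ 1) := by
  have hΛ : 1000 ≤ Λ := thousand_le_of_delta hδΛ hδ hδ'
  have hΛpos : 0 < Λ := by linarith
  have hs0 : 0 < s₀ := by linarith
  have hNΛ : 0 < N / Λ := div_pos hN hΛpos
  have hr1' : (1:ℝ) ≤ r := by linarith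
  -- facts at the interface
  have htc3 : ∀ x, x ≤ 1 → |W x| ≤ 1 / 4 ∧ 7 / 10 ≤ Real.exp x * S x ∧ Real.exp x * S x ≤ 1 :=
    fun x hx => ⟨(htc x hx).1, (htc x hx).2.2.1, (htc x hx).2.2.2⟩
  obtain ⟨heL, -, heΛL', hxL0, hst1, hst2, hst0, -⟩ := inner_atoms_at hδΛ hδ hδ' hs₀ hs₀' hxL htc3 htd (le_refl xL)
  have heΛL : Real.exp xL * Λ = 2 * s₀ := by rw [hxL]; field_simp
  have hxLneg : xL < 0 := by
    have h1 : Real.exp xL < 1 := by rw [hxL, div_lt_one hΛpos]; linarith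
    exact Real.exp_lt_one_iff.1 h1
  -- `S ≤ S(x_Λ) ≤ (Λ/2)(1 + 2δ²)` on `[x_Λ, 0]`, whence the zone-A size conditions
  have hSxL : S xL * (2 * s₀) ≤ Λ * (s₀ + δ ^ 2) := by
    have h1 : S xL * Real.exp xL ≤ s₀ + δ ^ 2 := by linarith [(abs_le.1 hst0).2]
    calc S xL * (2 * s₀) = S xL * Real.exp xL * Λ := by rw [← heΛL]; ring
      _ ≤ (s₀ + δ ^ 2) * Λ := mul_le_mul_of_nonneg_right h1 hΛpos.le
      _ = Λ * (s₀ + δ ^ 2) := by ring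
  have hδ2 : δ ^ 2 ≤ 1 / 1000000 := by
    calc δ ^ 2 ≤ (1 / 1000) ^ 2 := pow_le_pow_left₀ hδ.le hδ' 2
      _ = 1 / 1000000 := by norm_num
  have hsizeP : ∀ x, xL ≤ x → x ≤ 0 → 175 * S x ≤ 94 * Λ - 902 := by
    intro x hx1 hx2
    have h1 : S x ≤ S xL := hSanti xL x hx1 (by linarith)
    have h2 : S x * (2 * s₀) ≤ Λ * (s₀ + δ ^ 2) := (mul_le_mul_of_nonneg_right h1 (by linarith)).trans hSxL
    have hΛδ : Λ * δ ^ 2 ≤ Λ * (1 / 1000000) := mul_le_mul_of_nonneg_left hδ2 hΛpos.le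
    have hΛs : 7 / 10 * Λ ≤ Λ * s₀ := by nlinarith only [hs₀, hΛpos]
    have h3 : 175 * S x * (2 * s₀) ≤ (94 * Λ - 902) * (2 * s₀) := by
      have h4 : 175 * S x * (2 * s₀) ≤ 175 * (Λ * (s₀ + δ ^ 2)) := by nlinarith only [h2]
      nlinarith only [h4, hΛδ, hΛs, hs₀, hs₀', hΛ]
    exact le_of_mul_le_mul_right h3 (by linarith)
  have hsizeM : ∀ x, xL ≤ x → x ≤ 0 → 25 * S x ≤ 69 * Λ - 811 := by
    intro x hx1 hx2
    have := hsizeP x hx1 hx2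
    linarith
  -- source envelopes
  have hsrcP : ∀ x, |f₁ x + 3 * f₂ x| ≤ N * (1 + 4 * S x) := by
    intro x
    have hSx := hSpos x
    have hfx := hf x
    have hf1 : |f₁ x| ≤ N * (1 + S x) := by
      have h1 : |f₁ x| / (1 + S x) ≤ N := by linarith [div_nonneg (abs_nonneg (f₂ x)) hSx.le]
      rwa [div_le_iff₀ (by linarith)] at h1
    have hf2 : |f₂ x| ≤ N * S x := by
      have h1 : |f₂ x| / S x ≤ N := by linarith [div_nonneg (abs_nonneg (f₁ x)) (by linarith : (0:ℝ) ≤ 1 + S x)]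
      rwa [div_le_iff₀ hSx] at h1
    calc _ ≤ |f₁ x| + |3 * f₂ x| := abs_add_le _ _
      _ ≤ N * (1 + 4 * S x) := by rw [abs_mul, abs_of_pos (by norm_num : (0:ℝ) < 3)]; linarith
  have hsrcM : ∀ x, |f₁ x - 3 * f₂ x| ≤ N * (1 + 4 * S x) := by
    intro x
    have := hsrcP x
    have hSx := hSpos x
    have hfx := hf x
    have hf1 : |f₁ x| ≤ N * (1 + S x) := by
      have h1 : |f₁ x| / (1 + S x) ≤ N := by linarith [div_nonneg (abs_nonneg (f₂ x)) hSx.le]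
      rwa [div_le_iff₀ (by linarith)] at h1
    have hf2 : |f₂ x| ≤ N * S x := by
      have h1 : |f₂ x| / S x ≤ N := by linarith [div_nonneg (abs_nonneg (f₁ x)) (by linarith : (0:ℝ) ≤ 1 + S x)]
      rwa [div_le_iff₀ hSx] at h1
    calc _ ≤ |f₁ x| + |3 * f₂ x| := abs_sub _ _
      _ ≤ N * (1 + 4 * S x) := by rw [abs_mul, abs_of_pos (by norm_num : (0:ℝ) < 3)]; linarith
  -- barrier derivatives
  have hPbd : ∀ x, HasDerivAt (fun y => (N / Λ * (2 + 100 * S y) + η * Real.exp y)) (N / Λ * (100 * deriv S x) + η * Real.exp x) x := fun x => by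
    have h1 := (((hSd x).hasDerivAt.const_mul 100).const_add 2).const_mul (N / Λ) |>.add ((Real.hasDerivAt_exp x).const_mul η)
    refine h1.congr_deriv ?_; ring
  have hMbd : ∀ x, HasDerivAt (fun y => (N / Λ * (2 + 75 * S y) + η * Real.exp y)) (N / Λ * (75 * deriv S x) + η * Real.exp x) x := fun x => by
    have h1 := (((hSd x).hasDerivAt.const_mul 75).const_add 2).const_mul (N / Λ) |>.add ((Real.hasDerivAt_exp x).const_mul η)
    refine h1.congr_deriv ?_; ring
  have hPd : ∀ x, HasDerivAt (fun y => u₁ y + 3 * u₂ y) (deriv u₁ x + 3 * deriv u₂ x) x := fun x =>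
    (hu₁ x).hasDerivAt.add ((hu₂ x).hasDerivAt.const_mul 3)
  have hMd : ∀ x, HasDerivAt (fun y => u₁ y - 3 * u₂ y) (deriv u₁ x - 3 * deriv u₂ x) x := fun x =>
    (hu₁ x).hasDerivAt.sub ((hu₂ x).hasDerivAt.const_mul 3)
  have hPbpos : ∀ x, 0 < (N / Λ * (2 + 100 * S x) + η * Real.exp x) := fun x => by have := hSpos x; positivity
  have hMbpos : ∀ x, 0 < (N / Λ * (2 + 75 * S x) + η * Real.exp x) := fun x => by have := hSpos x; positivity
  -- the slack of the two barriers at any `x ≥ x_Λ`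
  have hslackP : ∀ x, xL ≤ x →
      3 / 2 * (N * (1 + 4 * S x)) - 13 * η ≤
        (Λ - (2 / 3 * deriv W x + 2 * W x - r + 2 * deriv S x + 4 * S x)) * (N / Λ * (2 + 100 * S x) + η * Real.exp x)
          - (W x - 1 + S x) * (N / Λ * (100 * deriv S x) + η * Real.exp x)
          - |deriv W x / 3 + deriv S x + 2 * S x| * (N / Λ * (2 + 75 * S x) + η * Real.exp x) := by
    intro x hx
    rcases le_or_gt x 0 with hx0 | hx0
    · obtain ⟨hW, hW', -, hSe⟩ := htc x (by linarith)
      exact outer_BP_zoneA hΛ hr1' hN hη (Real.exp_pos x) (Real.exp_le_one_iff.2 hx0)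
        (by rw [mul_comm]; exact hSe) (hSpos x) (hsizeP x hx hx0) hW hW' (hτ x hx0)
    · obtain ⟨hW, hW', hSB, hS'⟩ := hB0 x hx0.le
      have := outer_BP_zoneB (η := η) (e := Real.exp x) hB hΛB hr1' hN hη (Real.exp_pos x) (hSpos x) hSB hW hW' hS'
        (hsub x hx0.le)
      linarith
  have hslackM : ∀ x, xL ≤ x →
      3 / 2 * (N * (1 + 4 * S x)) - 13 * η ≤
        (Λ - (2 / 3 * deriv W x + 2 * W x - r - 2 * deriv S x - 4 * S x)) * (N / Λ * (2 + 75 * S x) + η * Real.exp x)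
          - (W x - 1 - S x) * (N / Λ * (75 * deriv S x) + η * Real.exp x)
          - |deriv W x / 3 - deriv S x - 2 * S x| * (N / Λ * (2 + 100 * S x) + η * Real.exp x) := by
    intro x hx
    rcases le_or_gt x 0 with hx0 | hx0
    · obtain ⟨hW, hW', -, -⟩ := htc x (by linarith)
      exact outer_BM_zoneA hΛ hr1' hN hη (Real.exp_pos x) (Real.exp_le_one_iff.2 hx0)
        (hSpos x) (hsizeM x hx hx0) hW hW' (hτ x hx0)
    · obtain ⟨hW, hW', hSB, hS'⟩ := hB0 x hx0.le
      have := outer_BM_zoneB (η := η) (e := Real.exp x) hB hΛB hr1' hN hη (Real.exp_pos x) (hSpos x) hSB hW hW' hS'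
        (hsub x hx0.le)
      linarith
  have hJ : ∀ x, 13 * η ≤ N * (1 + 4 * S x) / 4 := fun x => by
    have h1 := hSpos x
    have h2 : 0 ≤ N * S x := by positivity
    nlinarith only [h1, h2, hηN, hN]
  constructor
  · -- ===== `P` touches at `xs ≥ x_Λ` (interior or the outflow endpoint `x_Λ`) =====
    intro xs hxs htouch
    set bpp : ℝ := 2 / 3 * deriv W xs + 2 * W xs - r + 2 * deriv S xs + 4 * S xs with hbpp
    set bpm : ℝ := deriv W xs / 3 + deriv S xs + 2 * S xs with hbpm
    have hchar := charP_eq Λ r (W xs) (deriv W xs) (S xs) (deriv S xs) (u₁ xs) (deriv u₁ xs) (u₂ xs) (deriv u₂ xs)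
      (f₁ xs) (f₂ xs) (heq xs).1 (heq xs).2
    have hT := Literature.Analysis.ODE.barrier_touching' (x₁ := xL) (x₂ := xs + 1) (xs := xs) (θ := θ)
      (c := fun x => W x - 1 + S x) (β := fun _ => Λ - bpp)
      (h := fun _ => bpm * (u₁ xs - 3 * u₂ xs) + (f₁ xs + 3 * f₂ xs))
      (y := fun x => u₁ x + 3 * u₂ x) (y' := fun _ => deriv u₁ xs + 3 * deriv u₂ xs)
      (yb := fun y => (N / Λ * (2 + 100 * S y) + η * Real.exp y)) (yb' := fun _ => N / Λ * (100 * deriv S xs) + η * Real.exp xs)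
      ⟨hxs, by linarith⟩ (hPd xs) (hPbd xs) (fun x _ => hPbpos x) (fun x hx => hθP x hx.1) htouch
      (by rw [hbpp, hbpm]; linarith [hchar]) (fun h => by rw [h]; linarith [hsup xL hxLneg]) (fun h => by linarith)
    -- `|h| ≤ |b₊₋| θ M̄ + N(1 + 4S)`
    have hh : |bpm * (u₁ xs - 3 * u₂ xs) + (f₁ xs + 3 * f₂ xs)| ≤ |bpm| * (θ * (N / Λ * (2 + 75 * S xs) + η * Real.exp xs)) + N * (1 + 4 * S xs) := by
      calc _ ≤ |bpm * (u₁ xs - 3 * u₂ xs)| + |f₁ xs + 3 * f₂ xs| := abs_add_le _ _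
        _ ≤ _ := by
          rw [abs_mul]
          exact add_le_add (mul_le_mul_of_nonneg_left (hθM xs hxs) (abs_nonneg _)) (hsrcP xs)
    have hT2 : θ * ((Λ - bpp) * (N / Λ * (2 + 100 * S xs) + η * Real.exp xs) - (W xs - 1 + S xs) * (N / Λ * (100 * deriv S xs) + η * Real.exp xs)
        - |bpm| * (N / Λ * (2 + 75 * S xs) + η * Real.exp xs)) ≤ N * (1 + 4 * S xs) := by
      have h1 := hT.trans hh
      have e1 : θ * ((Λ - bpp) * (N / Λ * (2 + 100 * S xs) + η * Real.exp xs)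
          - (W xs - 1 + S xs) * (N / Λ * (100 * deriv S xs) + η * Real.exp xs)
          - |bpm| * (N / Λ * (2 + 75 * S xs) + η * Real.exp xs)) =
          θ * ((Λ - bpp) * (N / Λ * (2 + 100 * S xs) + η * Real.exp xs)
          - (W xs - 1 + S xs) * (N / Λ * (100 * deriv S xs) + η * Real.exp xs)) -
          |bpm| * (θ * (N / Λ * (2 + 75 * S xs) + η * Real.exp xs)) := by ring
      rw [e1]; linarith
    exact outer_touch_arith hθ (by have := hSpos xs; positivity) (hslackP xs hxs) (hJ xs) hT2
  · -- ===== `M` touches at `xs ≥ x_Λ` =====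
    intro xs hxs htouch
    rcases eq_or_lt_of_le hxs with hxe | hlt
    · -- the INFLOW endpoint `x_Λ`: interface argument
      subst hxe
      obtain ⟨hq, hMbar⟩ := packingResolventW_interfaceQ Λ δ s₀ N (Real.exp xL) (S xL) hδΛ hδ hδ' hs₀ heΛL hst1 hst0 hN
      -- `M(x_Λ) = U(x_Λ) + λ(ψ(2) − q φ(2))`, `q = 3s₀/(2 s̃)`
      have hst : 0 < S xL * Real.exp xL := by linarith
      have hu2 : u₂ xL = lam * (94253 / 51975 : ℝ) * s₀ / (2 * (S xL * Real.exp xL)) := by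
        have h1 : lam * (94253 / 51975) * s₀ ^ 2 = Λ * Real.exp xL ^ 2 * S xL * u₂ xL := by rw [hlam]; field_simp
        have h2 : Λ * Real.exp xL ^ 2 * S xL = 2 * s₀ * (S xL * Real.exp xL) := by
          calc Λ * Real.exp xL ^ 2 * S xL = (Real.exp xL * Λ) * (S xL * Real.exp xL) := by ring
            _ = 2 * s₀ * (S xL * Real.exp xL) := by rw [heΛL]
        have h3 : (u₂ xL * (2 * (S xL * Real.exp xL)) - lam * (94253 / 51975) * s₀) * s₀ = 0 := by
          linear_combination -h1 - u₂ xL * h2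
        have h4 : u₂ xL * (2 * (S xL * Real.exp xL)) - lam * (94253 / 51975) * s₀ = 0 := by
          rcases mul_eq_zero.1 h3 with h | h
          · exact h
          · exact absurd h hs0.ne'
        rw [eq_div_iff (by positivity)]
        linarith
      have hM : u₁ xL - 3 * u₂ xL = (u₁ xL - lam * (15193 / 10395 : ℝ)) +
          lam * ((15193 / 10395 : ℝ) - 3 * s₀ / (2 * (S xL * Real.exp xL)) * (94253 / 51975 : ℝ)) := by
        rw [hu2]; ring
      have hV29 : |lam| * (94253 / 51975) ≤ θ * (2921 / 100) * N := by
        have : 0 ≤ θ * N := by positivity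
        nlinarith only [hlamV, this]
      refine inner_interface_M (lam := lam) (Vabs := |lam| * (94253 / 51975)) (Mbar := N / Λ * (2 + 75 * S xL) + η * Real.exp xL)
        (refl := (15193 / 10395 : ℝ) - 3 * s₀ / (2 * (S xL * Real.exp xL)) * (94253 / 51975 : ℝ)) hθ hN ?_ hθU
        (bessel_reflection hq) (mul_le_mul_of_nonneg_left (by norm_num) (abs_nonneg lam)) hV29 ?_
      · have : 0 ≤ η * Real.exp xL := by positivity
        linarith
      · rw [← hM, htouch]
    · set bmm : ℝ := 2 / 3 * deriv W xs + 2 * W xs - r - 2 * deriv S xs - 4 * S xs with hbmm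
      set bmp : ℝ := deriv W xs / 3 - deriv S xs - 2 * S xs with hbmp
      have hchar := charM_eq Λ r (W xs) (deriv W xs) (S xs) (deriv S xs) (u₁ xs) (deriv u₁ xs) (u₂ xs) (deriv u₂ xs)
        (f₁ xs) (f₂ xs) (heq xs).1 (heq xs).2
      have hT := Literature.Analysis.ODE.barrier_touching' (x₁ := xL) (x₂ := xs + 1) (xs := xs) (θ := θ)
        (c := fun x => W x - 1 - S x) (β := fun _ => Λ - bmm)
        (h := fun _ => bmp * (u₁ xs + 3 * u₂ xs) + (f₁ xs - 3 * f₂ xs))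
        (y := fun x => u₁ x - 3 * u₂ x) (y' := fun _ => deriv u₁ xs - 3 * deriv u₂ xs)
        (yb := fun y => (N / Λ * (2 + 75 * S y) + η * Real.exp y)) (yb' := fun _ => N / Λ * (75 * deriv S xs) + η * Real.exp xs)
        ⟨hxs, by linarith⟩ (hMd xs) (hMbd xs) (fun x _ => hMbpos x) (fun x hx => hθM x hx.1) htouch
        (by rw [hbmm, hbmp]; linarith [hchar]) (fun h => absurd h (ne_of_gt hlt)) (fun h => by linarith)
      have hh : |bmp * (u₁ xs + 3 * u₂ xs) + (f₁ xs - 3 * f₂ xs)| ≤ |bmp| * (θ * (N / Λ * (2 + 100 * S xs) + η * Real.exp xs)) + N * (1 + 4 * S xs) := by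
        calc _ ≤ |bmp * (u₁ xs + 3 * u₂ xs)| + |f₁ xs - 3 * f₂ xs| := abs_add_le _ _
          _ ≤ _ := by
            rw [abs_mul]
            exact add_le_add (mul_le_mul_of_nonneg_left (hθP xs hxs) (abs_nonneg _)) (hsrcM xs)
      have hT2 : θ * ((Λ - bmm) * (N / Λ * (2 + 75 * S xs) + η * Real.exp xs) - (W xs - 1 - S xs) * (N / Λ * (75 * deriv S xs) + η * Real.exp xs)
          - |bmp| * (N / Λ * (2 + 100 * S xs) + η * Real.exp xs)) ≤ N * (1 + 4 * S xs) := by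
        have h1 := hT.trans hh
        have e1 : θ * ((Λ - bmm) * (N / Λ * (2 + 75 * S xs) + η * Real.exp xs)
            - (W xs - 1 - S xs) * (N / Λ * (75 * deriv S xs) + η * Real.exp xs)
            - |bmp| * (N / Λ * (2 + 100 * S xs) + η * Real.exp xs)) =
            θ * ((Λ - bmm) * (N / Λ * (2 + 75 * S xs) + η * Real.exp xs)
            - (W xs - 1 - S xs) * (N / Λ * (75 * deriv S xs) + η * Real.exp xs)) -
            |bmp| * (θ * (N / Λ * (2 + 100 * S xs) + η * Real.exp xs)) := by ring
        rw [e1]; linarith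
      exact outer_touch_arith hθ (by have := hSpos xs; positivity) (hslackM xs hxs) (hJ xs) hT2

end Summit.AtomisticToContinuum.HydrodynamicLimit.Theorems.PackingAnalyticImplosion

end
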